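import Literature.Probability.RandomPlanarGeometry.SLETraceHittingMarkov
import HarnessLib

/-!
# The freezing formula for the SLE trace at the hitting time of a closed set
# (brick S5a of `stub_isDomainMarkov`, crux `CardyRotToConfR2SymmetryUpgrade`,
# stmt-CriticalPhenomena-0698)

Stub `stub_sleTraceHittingMarkov` of line `germ-label-transport` (lead skeleton
`CardyRotToConfR2SymmetryUpgrade`, brick S5a of `stub_isDomainMarkov`): the strong Markov
property / freezing formula for the chordal SLE_κ trace at the FIRST HITTING TIME `τ` of a
closed set `A ⊆ ℂ` BY THE TRACE,
`E[F(past, γ^τ); τ < ∞] = E[E_{ω'}[F(past(ω), γ(ω'))]; τ < ∞]` for bounded jointly measurable `F`,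
with `past ω = (W(· ∧ τ), τ)`. This file is a wrapper, in the registered one-line form, of the
Literature theorem `setIntegral_sleTraceAfter_hitting_eq_setIntegral_integral` of
`Literature/Probability/RandomPlanarGeometry/SLETraceHittingMarkov.lean`, where the mathematics
lives: the hitting time is a.s. an optional time of the raw Brownian filtration (hitting time of
`A` by the adapted boundary-limit version of the trace), and the strong Markov property of
Brownian motion holds at optional times (Le Gall (2016), Thm. 2.20 with `(𝓕ₜ₊)`).

References: S. Rohde, O. Schramm, *Basic properties of SLE*, Ann. of Math. 161 (2005), Prop. 2.1
and §7 p. 911; G. F. Lawler, *Conformally Invariant Processes in the Plane* (2005), §6.2;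
J.-F. Le Gall, *Brownian Motion, Martingales, and Stochastic Calculus* (2016), Thm. 2.20.
-/

noncomputable section

open MeasureTheory
open Literature.Probability Literature.Probability.RandomPlanarGeometry

namespace Summit.CriticalPhenomena.CardyFormulaZ2.Theorems.CardyRotToConfR2SymmetryUpgrade

/-- **Stub `stub_sleTraceHittingMarkov`** (brick S5a of `stub_isDomainMarkov`, registered form):
for `κ > 0` with `HasSLETrace κ`, a closed `A ⊆ ℂ`, `τ = hittingAfter (t ω ↦ γ_ω(t)) A 0` the
first hitting time of `A` by the SLE_κ trace, and `F` bounded and jointly measurable,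
`∫_{τ < ∞} F((W(· ∧ τ), τ), γ^τ) dP = ∫_{τ < ∞} (∫ F((W(· ∧ τ), τ)(ω), γ(ω')) dP(ω')) dP(ω)`
(`setIntegral_sleTraceAfter_hitting_eq_setIntegral_integral`). Rohde–Schramm (2005), Prop. 2.1
and §7 p. 911. -/
theorem stub_sleTraceHittingMarkov :
    ∀ (κ : NNReal), HasSLETrace κ → 0 < κ → ∀ (A : Set ℂ), IsClosed A → ∀ (F : ((NNReal → ℝ) ×
      WithTop NNReal) → (NNReal → ℂ) → ℝ), Measurable (Function.uncurry F) → ∀ C : ℝ, (∀ x γ, |F x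
      γ| ≤ C) → ∫ ω in {ω | hittingAfter (fun t ω ↦ sleTrace κ ω t) A 0 ω ≠ ⊤}, F ((fun u ↦
      sleDriving κ ω (min u ((hittingAfter (fun t ω ↦ sleTrace κ ω t) A 0 ω).untopD 0))),
      hittingAfter (fun t ω ↦ sleTrace κ ω t) A 0 ω) (sleTraceAfter κ (hittingAfter (fun t ω ↦
      sleTrace κ ω t) A 0) ω) ∂Process.preWienerMeasure = ∫ ω in {ω | hittingAfter (fun t ω ↦
      sleTrace κ ω t) A 0 ω ≠ ⊤}, (∫ ω', F ((fun u ↦ sleDriving κ ω (min u ((hittingAfter (fun t ω ↦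
      sleTrace κ ω t) A 0 ω).untopD 0))), hittingAfter (fun t ω ↦ sleTrace κ ω t) A 0 ω) (sleTrace κ
      ω') ∂Process.preWienerMeasure) ∂Process.preWienerMeasure :=
  fun _ h0 hκ _ hA _ hFm _ hFb ↦
    setIntegral_sleTraceAfter_hitting_eq_setIntegral_integral h0 hκ hA hFm hFb

end Summit.CriticalPhenomena.CardyFormulaZ2.Theorems.CardyRotToConfR2SymmetryUpgrade
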